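import Summits.AtomisticToContinuum.Crystallization.Theorems.ThreeConeCertificateSlackRigidityPricedFloorsDefs
import Summits.AtomisticToContinuum.Crystallization.Theorems.ExcessDecayLiouvilleFarField
import HarnessLib

/-!
# `SlackRigidity` (stmt-AtomisticToContinuum-11960), line `priced-floors-palm-exactification`:
# the free window lower bound (L), hazard-free port

Worker stub `stub_windowLowerBound` of the line (lead c19), S3 energetics.  This module is a
HAZARD-FREE PORT of the site-energy `tsum` toolkit `LayeredHull.wb_*` of
`PhononSlackCertificatesPeriodicGivenLayeredWindowBounds1`: that module imports
`Literature.MathematicalPhysics.StatisticalMechanics.LocalLimitOfGroundStates` (hence, transitively,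
`…MuGroundStateConfiguration`) and therefore cannot be imported next to the
`ThreeConeCertificateSlackRigidityLaw*` / `…PricedFloorsSelection` modules of this line.  Here the
same statements are re-proved importing only `…PricedFloorsDefs` (for `E3 = ℝ³`) and
`ExcessDecayLiouvilleFarField` (for the packing bound `sum_inv_pow_le_of_separated`), both of which
co-import with the `Law*` files.

For a `δ`-separated set `S ⊆ ℝ³` and a point `p ∈ S` the site energy
`e_p(S) = Σ'_{q ∈ S, q ≠ p} V_LJ(|p − q|)` is a genuine (absolutely convergent) sum:

* `wl_summable`: the family `q ↦ V_LJ(|p − q|)` over `{q ∈ S, q ≠ p}` is summable (domination by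
  `C(δ)|p − q|⁻⁶` and the dyadic-shell packing bound);
* `wl_neg_le_tsum_of_far`: the attractive tail over any family of points of `S` at distance
  `≥ ρ ≥ δ` from `p` is `≥ −(1/6)·1024/(δ³ρ³)`;
* `wl_exists_nearFinset`, `wl_card_near_le`: the points of `S` within `L` of `p` form a finite
  set of at most `(2L/δ + 1)³` elements;
* `wl_tsum_le_near`: for `L ≥ 1`, `e_p(S) ≤ Σ_{q ≠ p, |p − q| < L} V_LJ(|p − q|)` (far terms are
  `≤ 0`);
* `wl_two_mul_groundStateEnergy_le`: `2 E(#W) ≤ Σ_{p, q ∈ W} V_LJ(|p − q|)` for finite `W ⊆ ℝ³`;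
* `wl_site_split`, `wl_lower` and the registered stub `stub_windowLowerBound` — **(L)**: for every
  `δ > 0` there is `C` with `2 E(#W) − C Σ_{p ∈ W} (1 + dist(p, S ∖ W))⁻³ ≤ Σ_{p ∈ W} e_p(S)` for
  all `δ`-separated `S` and finite `W ⊆ S` (`E(#W) ≤` the energy of `W`, and the attraction across
  `∂W` is a tail sum).

All `[folklore]`; nothing here closes the item.
-/

noncomputable section

namespace Summit.AtomisticToContinuum.Crystallization.Theorems.SlackRigidityPricedFloorsWindowLower

open scoped BigOperators
open Literature.MathematicalPhysics.StatisticalMechanics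
open Summit.AtomisticToContinuum.Crystallization.Theorems.SlackRigidityPricedFloors
open Summit.AtomisticToContinuum.Crystallization.Theorems.ExcessDecayLiouville
  (sum_inv_pow_le_of_separated)

/-! ### The attractive tail over a separated set -/

-- adapted from PhononSlackCertificatesPeriodicGivenLayeredWindowBounds1 (LayeredHull.wb_neg_le_tsum_of_far)
/-- **Attractive tail over a separated set.** For a `δ`-separated `S ⊆ ℝ³`, a point `p` and an
injective family `v` of points of `S` all at distance `≥ ρ ≥ δ` from `p`, with summable
Lennard-Jones terms: `−(1/6)·1024/(δ³ρ³) ≤ Σ' V_LJ(|p − vᵢ|)` (`V_LJ(r) ≥ −r⁻⁶/6` and the packing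
bound `Σ |vᵢ − p|⁻⁶ ≤ 1024/(δ³ρ³)`).  Hazard-free port of `LayeredHull.wb_neg_le_tsum_of_far`.
[folklore] -/
theorem wl_neg_le_tsum_of_far {ι : Type*} {S : Set E3} {δ ρ : ℝ}
    (hδ : 0 < δ) (hδρ : δ ≤ ρ) (hS : ∀ a ∈ S, ∀ b ∈ S, a ≠ b → δ ≤ dist a b)
    (p : E3) {v : ι → E3}
    (hv : Function.Injective v) (hvS : ∀ i, v i ∈ S) (hfar : ∀ i, ρ ≤ dist p (v i))
    (hsum : Summable fun i => lennardJones (dist p (v i))) :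
    -(1 / 6 * (1024 / (δ ^ 3 * ρ ^ 3))) ≤ ∑' i, lennardJones (dist p (v i)) := by
  classical
  have hρ : 0 < ρ := hδ.trans_le hδρ
  set g : ι → ℝ := fun i => 1 / 6 * (dist (v i) p)⁻¹ ^ (3 + 3) with hg
  have hg0 : ∀ i, 0 ≤ g i := fun i => by positivity
  have hgle : ∀ u : Finset ι, ∑ i ∈ u, g i ≤ 1 / 6 * (1024 / (δ ^ 3 * ρ ^ 3)) := by
    intro u
    rw [← Finset.mul_sum]
    refine mul_le_mul_of_nonneg_left ?_ (by norm_num)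
    have h := sum_inv_pow_le_of_separated (u.image v) p (k := 3) (by norm_num) hδ hδρ ?_ ?_
    · rwa [Finset.sum_image fun a _ b _ h => hv h] at h
    · intro a ha b hb hab
      obtain ⟨i, -, rfl⟩ := Finset.mem_image.1 ha
      obtain ⟨j, -, rfl⟩ := Finset.mem_image.1 hb
      exact hS _ (hvS i) _ (hvS j) hab
    · intro a ha
      obtain ⟨i, -, rfl⟩ := Finset.mem_image.1 ha
      rw [dist_comm]
      exact hfar i
  have hgs : Summable g := summable_of_sum_le hg0 hgle
  have hfg : ∀ i, -g i ≤ lennardJones (dist p (v i)) := by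
    intro i
    have h := neg_le_lennardJones_of_le (hρ.trans_le (hfar i)) le_rfl
    have e : g i = 1 / 6 * (dist p (v i))⁻¹ ^ 6 := by
      simp only [hg, dist_comm (v i) p]
    rw [e]
    exact h
  have h1 : ∑' i, -g i ≤ ∑' i, lennardJones (dist p (v i)) :=
    Summable.tsum_le_tsum hfg hgs.neg hsum
  rw [tsum_neg] at h1
  have h2 : ∑' i, g i ≤ 1 / 6 * (1024 / (δ ^ 3 * ρ ^ 3)) := hgs.tsum_le_of_sum_le hgle
  linarith

/-! ### Summability of the site energy -/

-- adapted from PhononSlackCertificatesPeriodicGivenLayeredWindowBounds1 (LayeredHull.wb_summable)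
/-- **The site energy of a separated set is an absolutely convergent sum**: for `δ`-separated `S`
and `p ∈ S`, `q ↦ V_LJ(|p − q|)` is summable over `{q ∈ S, q ≠ p}` (`|V_LJ(r)| ≤ (δ⁻⁶/12 + 1/6) r⁻⁶`
for `r ≥ δ`, and the packing bound).  Hazard-free port of `LayeredHull.wb_summable`. [folklore] -/
theorem wl_summable {S : Set E3} {δ : ℝ} (hδ : 0 < δ)
    (hS : ∀ a ∈ S, ∀ b ∈ S, a ≠ b → δ ≤ dist a b) {p : E3} (hp : p ∈ S) :
    Summable fun q : {q // q ∈ S ∧ q ≠ p} => lennardJones (dist p q.1) := by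
  classical
  set K : ℝ := 1 / 12 * δ⁻¹ ^ 6 + 1 / 6 with hK
  have hK0 : 0 ≤ K := by positivity
  set g : {q // q ∈ S ∧ q ≠ p} → ℝ := fun q => K * (dist q.1 p)⁻¹ ^ (3 + 3) with hg
  have hg0 : ∀ q, 0 ≤ g q := fun q => by positivity
  have hfar : ∀ q : {q // q ∈ S ∧ q ≠ p}, δ ≤ dist p q.1 :=
    fun q => hS p hp q.1 q.2.1 (Ne.symm q.2.2)
  have hgle : ∀ u : Finset {q // q ∈ S ∧ q ≠ p}, ∑ q ∈ u, g q ≤ K * (1024 / (δ ^ 3 * δ ^ 3)) := by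
    intro u
    rw [← Finset.mul_sum]
    refine mul_le_mul_of_nonneg_left ?_ hK0
    have h := sum_inv_pow_le_of_separated (u.map (Function.Embedding.subtype _)) p (k := 3)
      (by norm_num) hδ le_rfl ?_ ?_
    · rwa [Finset.sum_map] at h
    · intro a ha b hb hab
      simp only [Finset.mem_map, Function.Embedding.coe_subtype] at ha hb
      obtain ⟨a', -, rfl⟩ := ha
      obtain ⟨b', -, rfl⟩ := hb
      exact hS _ a'.2.1 _ b'.2.1 hab
    · intro a ha
      simp only [Finset.mem_map, Function.Embedding.coe_subtype] at ha
      obtain ⟨a', -, rfl⟩ := ha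
      rw [dist_comm]
      exact hfar a'
  have hgs : Summable g := summable_of_sum_le hg0 hgle
  refine Summable.of_norm_bounded hgs fun q => ?_
  have hr : δ ≤ dist p q.1 := hfar q
  have hi0 : 0 ≤ (dist p q.1)⁻¹ := inv_nonneg.2 dist_nonneg
  have hinv : (dist p q.1)⁻¹ ≤ δ⁻¹ := inv_anti₀ hδ hr
  have h6 : (dist p q.1)⁻¹ ^ 6 ≤ δ⁻¹ ^ 6 := pow_le_pow_left₀ hi0 hinv 6
  have e : g q = K * (dist p q.1)⁻¹ ^ 6 := by
    simp only [hg, dist_comm q.1 p]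
  rw [Real.norm_eq_abs, e, abs_le, hK]
  have h12 : (dist p q.1)⁻¹ ^ 12 = ((dist p q.1)⁻¹ ^ 6) ^ 2 := by ring
  have hu0 : 0 ≤ (dist p q.1)⁻¹ ^ 6 := pow_nonneg hi0 6
  have huu : ((dist p q.1)⁻¹ ^ 6) ^ 2 ≤ δ⁻¹ ^ 6 * (dist p q.1)⁻¹ ^ 6 := by
    rw [sq]
    exact mul_le_mul_of_nonneg_right h6 hu0
  unfold lennardJones
  rw [h12]
  constructor
  · nlinarith [mul_nonneg (by positivity : (0 : ℝ) ≤ 1 / 12 * δ⁻¹ ^ 6) hu0,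
      sq_nonneg ((dist p q.1)⁻¹ ^ 6)]
  · nlinarith

/-! ### Finite neighbourhoods -/

-- adapted from PhononSlackCertificatesPeriodicGivenLayeredWindowBounds1 (LayeredHull.wb_exists_nearFinset)
/-- The points of a `δ`-separated `S` other than `p` within distance `< L` of `p` form a finite set
(packing).  Hazard-free port of `LayeredHull.wb_exists_nearFinset`. [folklore] -/
theorem wl_exists_nearFinset {S : Set E3} {δ : ℝ} (hδ : 0 < δ)
    (hS : ∀ a ∈ S, ∀ b ∈ S, a ≠ b → δ ≤ dist a b) (p : E3) (L : ℝ) :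
    ∃ F : Finset {q // q ∈ S ∧ q ≠ p}, ∀ q, q ∈ F ↔ dist p q.1 < L := by
  classical
  rcases lt_or_ge L 0 with hL | hL
  · refine ⟨∅, fun q => ?_⟩
    simp only [Finset.notMem_empty, false_iff, not_lt]
    exact hL.le.trans dist_nonneg
  have hfin : ({q | q ∈ S ∧ dist q p ≤ L}).Finite := by
    by_contra hinf
    obtain ⟨n, hn⟩ := exists_nat_gt ((2 * L / δ + 1) ^ 3)
    obtain ⟨t, ht, htc⟩ := Set.Infinite.exists_subset_card_eq hinf n
    have h := card_le_of_separated_of_dist_le t p hδ hL (fun c hc => (ht hc).2)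
      (fun c hc d hd hcd => hS c (ht hc).1 d (ht hd).1 hcd)
    rw [finrank_euclideanSpace_fin, htc] at h
    linarith
  refine ⟨(hfin.toFinset.subtype fun q => q ∈ S ∧ q ≠ p).filter fun q => dist p q.1 < L,
    fun q => ?_⟩
  simp only [Finset.mem_filter, Finset.mem_subtype, Set.Finite.mem_toFinset, Set.mem_setOf_eq]
  constructor
  · exact fun h => h.2
  · intro h
    refine ⟨⟨q.2.1, ?_⟩, h⟩
    rw [dist_comm]
    exact h.le

-- adapted from PhononSlackCertificatesPeriodicGivenLayeredWindowBounds1 (LayeredHull.wb_card_near_le)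
/-- The number of points of a `δ`-separated `S` within `L` of a point is at most `(2L/δ + 1)³`.
Hazard-free port of `LayeredHull.wb_card_near_le`. [folklore] -/
theorem wl_card_near_le {S : Set E3} {δ : ℝ} (hδ : 0 < δ)
    (hS : ∀ a ∈ S, ∀ b ∈ S, a ≠ b → δ ≤ dist a b) (p : E3) {L : ℝ}
    (hL : 0 ≤ L) (F : Finset {q // q ∈ S ∧ q ≠ p}) (hF : ∀ q, q ∈ F ↔ dist p q.1 < L) :
    (F.card : ℝ) ≤ (2 * L / δ + 1) ^ 3 := by
  classical
  have h := card_le_of_separated_of_dist_le (F.map (Function.Embedding.subtype _)) p hδ hL ?_ ?_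
  · rwa [Finset.card_map, finrank_euclideanSpace_fin] at h
  · intro c hc
    simp only [Finset.mem_map, Function.Embedding.coe_subtype] at hc
    obtain ⟨q, hq, rfl⟩ := hc
    rw [dist_comm]
    exact ((hF q).1 hq).le
  · intro c hc d hd hcd
    simp only [Finset.mem_map, Function.Embedding.coe_subtype] at hc hd
    obtain ⟨q, -, rfl⟩ := hc
    obtain ⟨q', -, rfl⟩ := hd
    exact hS _ q.2.1 _ q'.2.1 hcd

-- adapted from PhononSlackCertificatesPeriodicGivenLayeredWindowBounds1 (LayeredHull.wb_tsum_le_near)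
/-- **Near/far splitting.** For `L ≥ 1` and `p ∈ S` (`δ`-separated), the site energy is at most
its near part: `e_p(S) ≤ Σ_{q ≠ p, |p − q| < L} V_LJ(|p − q|)` (`V_LJ ≤ 0` beyond distance `1`).
Hazard-free port of `LayeredHull.wb_tsum_le_near`. [folklore] -/
theorem wl_tsum_le_near {S : Set E3} {δ : ℝ} (hδ : 0 < δ)
    (hS : ∀ a ∈ S, ∀ b ∈ S, a ≠ b → δ ≤ dist a b) {p : E3} (hp : p ∈ S)
    {L : ℝ} (hL : 1 ≤ L) (F : Finset {q // q ∈ S ∧ q ≠ p}) (hF : ∀ q, q ∈ F ↔ dist p q.1 < L) :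
    ∑' q : {q // q ∈ S ∧ q ≠ p}, lennardJones (dist p q.1) ≤
      ∑ q ∈ F, lennardJones (dist p q.1) := by
  have hs := wl_summable hδ hS hp
  rw [← hs.sum_add_tsum_compl (s := F)]
  have h : ∑' q : ((F : Set {q // q ∈ S ∧ q ≠ p})ᶜ : Set _), lennardJones (dist p q.1.1) ≤ 0 := by
    refine tsum_nonpos fun q => lennardJones_nonpos ?_
    have : ¬ dist p q.1.1 < L := fun hlt => q.2 ((hF q.1).2 hlt)
    linarith [not_lt.1 this]
  linarith

/-! ### The lower bound (L) -/

-- adapted from PhononSlackCertificatesPeriodicGivenLayeredWindowBounds1 (LayeredHull.wb_two_mul_groundStateEnergy_le)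
/-- `2 E(#W) ≤ Σ_{p ∈ W} Σ_{q ∈ W} V_LJ(|p − q|)` for a finite `W ⊆ ℝ³`: enumerate `W` injectively,
`E(#W) ≤` its energy (`groundStateEnergy_lennardJones_le`), and twice the energy is the full double
sum (`V_LJ(0) = 0`).  Hazard-free port of `LayeredHull.wb_two_mul_groundStateEnergy_le`.
[folklore] -/
theorem wl_two_mul_groundStateEnergy_le (W : Finset E3) :
    2 * groundStateEnergy lennardJones 3 W.card ≤ ∑ p ∈ W, ∑ q ∈ W, lennardJones (dist p q) := by
  set w : Fin W.card → E3 := fun i => (W.equivFin.symm i).1 with hw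
  have hwinj : Function.Injective w := fun i j h =>
    W.equivFin.symm.injective (Subtype.ext h)
  have h1 := groundStateEnergy_lennardJones_le (d := 3) hwinj
  have h2 := two_mul_interactionEnergy_eq_sum_sum lennardJones lennardJones_zero w
  have e1 : ∀ a : E3,
      ∑ k, lennardJones (dist a (w k)) = ∑ q ∈ W, lennardJones (dist a q) := by
    intro a
    rw [← Finset.sum_coe_sort W]
    exact Equiv.sum_comp W.equivFin.symm (fun q : ↥W => lennardJones (dist a q.1))
  have h3 : ∑ i, ∑ k, lennardJones (dist (w i) (w k)) =
      ∑ p ∈ W, ∑ q ∈ W, lennardJones (dist p q) := by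
    simp_rw [e1]
    rw [← Finset.sum_coe_sort W]
    exact Equiv.sum_comp W.equivFin.symm (fun a : ↥W => ∑ q ∈ W, lennardJones (dist a.1 q))
  linarith

-- adapted from PhononSlackCertificatesPeriodicGivenLayeredWindowBounds1 (LayeredHull.wb_site_split)
/-- **Per-site split with tail bound.** For `δ`-separated `S`, finite `W ⊆ S` and `p ∈ W`:
`Σ_{q ∈ W} V_LJ(|p − q|) − (1024/(6δ³))(1 + δ⁻¹)³ (1 + dist(p, S ∖ W))⁻³ ≤ e_p(S)` (split the
summable site energy along `W`; the rest lives on `S ∖ W`, at distance `≥ max(δ, dist(p, S ∖ W))`).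
Hazard-free port of `LayeredHull.wb_site_split`. [folklore] -/
theorem wl_site_split {S : Set E3} {δ : ℝ} (hδ : 0 < δ)
    (hS : ∀ a ∈ S, ∀ b ∈ S, a ≠ b → δ ≤ dist a b) {W : Finset E3}
    (hW : (↑W : Set E3) ⊆ S) {p : E3} (hp : p ∈ W) :
    ∑ q ∈ W, lennardJones (dist p q) -
        1024 / (6 * δ ^ 3) * (1 + δ⁻¹) ^ 3 *
          (1 + Metric.infDist p (S \ (↑W : Set E3)))⁻¹ ^ 3 ≤
      ∑' q : {q // q ∈ S ∧ q ≠ p}, lennardJones (dist p q.1) := by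
  classical
  have hpS : p ∈ S := hW hp
  have hs := wl_summable hδ hS hpS
  set F : Finset {q // q ∈ S ∧ q ≠ p} := W.subtype fun q => q ∈ S ∧ q ≠ p with hFdef
  rw [← hs.sum_add_tsum_compl (s := F)]
  -- the finite part
  have h1 : ∑ q ∈ F, lennardJones (dist p q.1) = ∑ q ∈ W, lennardJones (dist p q) := by
    rw [hFdef, Finset.sum_subtype_eq_sum_filter (f := fun q => lennardJones (dist p q))]
    have : W.filter (fun q => q ∈ S ∧ q ≠ p) = W.erase p := by
      ext q
      simp only [Finset.mem_filter, Finset.mem_erase]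
      constructor
      · rintro ⟨hq, -, hne⟩
        exact ⟨hne, hq⟩
      · rintro ⟨hne, hq⟩
        exact ⟨hq, hW hq, hne⟩
    rw [this, Finset.sum_erase]
    rw [dist_self, lennardJones_zero]
  -- the tail part
  set r := Metric.infDist p (S \ (↑W : Set E3)) with hr
  have hr0 : 0 ≤ r := Metric.infDist_nonneg
  set ρ := max δ r with hρ
  have hδρ : δ ≤ ρ := le_max_left _ _
  have hρ0 : 0 < ρ := hδ.trans_le hδρ
  have hmem : ∀ q : ((F : Set {q // q ∈ S ∧ q ≠ p})ᶜ : Set _),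
      q.1.1 ∈ S \ (↑W : Set E3) := fun q =>
    ⟨q.1.2.1, fun hqW => q.2 (Finset.mem_subtype.2 hqW)⟩
  have hfar : ∀ q : ((F : Set {q // q ∈ S ∧ q ≠ p})ᶜ : Set _), ρ ≤ dist p q.1.1 := fun q =>
    max_le (hS p hpS _ q.1.2.1 (Ne.symm q.1.2.2)) (Metric.infDist_le_dist_of_mem (hmem q))
  have htail := wl_neg_le_tsum_of_far hδ hδρ hS p
    (v := fun q : ((F : Set {q // q ∈ S ∧ q ≠ p})ᶜ : Set _) => q.1.1)
    (fun a b h => Subtype.ext (Subtype.ext h)) (fun q => q.1.2.1) hfar (hs.subtype _)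
  -- comparison of constants
  have hkey : 1 / 6 * (1024 / (δ ^ 3 * ρ ^ 3)) ≤
      1024 / (6 * δ ^ 3) * (1 + δ⁻¹) ^ 3 * (1 + r)⁻¹ ^ 3 := by
    have h1r : 0 < 1 + r := by linarith
    have hle : 1 + r ≤ (1 + δ⁻¹) * ρ := by
      have hrρ : r ≤ ρ := le_max_right _ _
      have h1 : 1 ≤ δ⁻¹ * ρ := by
        rw [le_inv_mul_iff₀ hδ, mul_one]
        exact hδρ
      nlinarith
    have h3 : (1 + r) ^ 3 ≤ ((1 + δ⁻¹) * ρ) ^ 3 := pow_le_pow_left₀ h1r.le hle 3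
    have hfrac : 1 / ρ ^ 3 ≤ (1 + δ⁻¹) ^ 3 / (1 + r) ^ 3 := by
      rw [div_le_div_iff₀ (by positivity) (by positivity), one_mul, ← mul_pow]
      exact h3
    calc 1 / 6 * (1024 / (δ ^ 3 * ρ ^ 3)) = 1024 / (6 * δ ^ 3) * (1 / ρ ^ 3) := by
          field_simp
      _ ≤ 1024 / (6 * δ ^ 3) * ((1 + δ⁻¹) ^ 3 / (1 + r) ^ 3) :=
          mul_le_mul_of_nonneg_left hfrac (by positivity)
      _ = 1024 / (6 * δ ^ 3) * (1 + δ⁻¹) ^ 3 * (1 + r)⁻¹ ^ 3 := by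
          rw [inv_pow]
          ring
  linarith

-- adapted from PhononSlackCertificatesPeriodicGivenLayeredWindowBounds1 (LayeredHull.wb_lower)
/-- **(L) The free lower bound.** For every `δ > 0` there is `C` such that for every `δ`-separated
`S ⊆ ℝ³` and every finite `W ⊆ S`,
`2 E(#W) − C Σ_{p ∈ W} (1 + dist(p, S ∖ W))⁻³ ≤ Σ_{p ∈ W} e_p(S)`: `E(#W)` is at most the energy of
`W` itself and the attraction across `∂W` is a boundary-layer sum (`C = (1024/(6δ³))(1 + δ⁻¹)³`).
Hazard-free port of `LayeredHull.wb_lower`. [folklore] -/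
theorem wl_lower : ∀ δ : ℝ, 0 < δ → ∃ C : ℝ, ∀ S : Set E3,
    (∀ p ∈ S, ∀ q ∈ S, p ≠ q → δ ≤ dist p q) →
      ∀ W : Finset E3, (↑W : Set E3) ⊆ S →
        2 * groundStateEnergy lennardJones 3 W.card -
            C * ∑ p ∈ W, (1 + Metric.infDist p (S \ (↑W : Set E3)))⁻¹ ^ 3 ≤
          ∑ p ∈ W, (∑' q : {q : E3 // q ∈ S ∧ q ≠ p}, lennardJones (dist p (q : E3))) := by
  intro δ hδ
  refine ⟨1024 / (6 * δ ^ 3) * (1 + δ⁻¹) ^ 3, fun S hS W hW => ?_⟩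
  have hsplit := Finset.sum_le_sum fun p hp => wl_site_split hδ hS hW hp
  rw [Finset.sum_sub_distrib, ← Finset.mul_sum] at hsplit
  have hE := wl_two_mul_groundStateEnergy_le W
  linarith

/-- **Registered stub `stub_windowLowerBound` (S3 energetics, the free lower bound (L)).**  For
every `δ > 0` there is `C` such that for every `δ`-separated `S ⊆ ℝ³` and every finite `W ⊆ S`,
`2 E(#W) − C Σ_{p ∈ W} (1 + dist(p, S ∖ W))⁻³ ≤ Σ_{p ∈ W} e_p(S)`.  This is a HAZARD-FREE
RE-EXPORT of the landed theorem `LayeredHull.wb_lower`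
(`PhononSlackCertificatesPeriodicGivenLayeredWindowBounds1`, which is `…MuGroundStateConfiguration`
-side and cannot be imported with the `Law*` files of this line): same statement, same proof,
hazard-free imports. [folklore] -/
theorem stub_windowLowerBound : ∀ δ : ℝ, 0 < δ → ∃ C : ℝ, ∀ S : Set E3, (∀ p ∈ S, ∀ q ∈ S, p ≠ q → δ ≤ dist p q) → ∀ W : Finset E3, (↑W : Set E3) ⊆ S → 2 * groundStateEnergy lennardJones 3 W.card - C * ∑ p ∈ W, (1 + Metric.infDist p (S \ (↑W : Set E3)))⁻¹ ^ 3 ≤ ∑ p ∈ W, (∑' q : {q : E3 // q ∈ S ∧ q ≠ p}, lennardJones (dist p (q : E3))) :=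
  wl_lower

end Summit.AtomisticToContinuum.Crystallization.Theorems.SlackRigidityPricedFloorsWindowLower

end
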